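import Mathlib
import Literature.Geometry.Lorentzian.KerrConvergence
import Literature.Geometry.Lorentzian.KerrSchild
import HarnessLib

/-!
# LateEscape

Topic `Literature/Uncategorized`. The "late escaping sequence" predicate of the crux `NeckGapDecay`
(route StarvedNecks of `FinalStateConjecture`), verbatim the definition of the line skeleton, given a
Literature-level name so that the registered stubs `SubwallClosureOfNoEscape` / `NoLateEscape` can be stated
over Literature-level names only (the gate relocates those closed statements next to this file).

* `Literature.Uncategorized.LateEscape`
-/

namespace Literature.Uncategorized

open scoped Manifold ContDiff Topology ENNReal
open Filter Set MeasureTheory Topology Literature.Geometry.Lorentzian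

/-- **Late escaping sequence** of a chart `Ψg` of the model background `B` into the spacetime `𝓢`, from chart
time `τ₂`, outside radius `R₁+1`, under the wall `W`, accumulating in `O`: a sequence `xₙ` in the domain of
`B` with chart times `B.time xₙ → ∞`, `τ₂ ≤ B.time xₙ`, radii `R₁ + 1 ≤ B.radius xₙ ≤ W(xₙ⁰)`, whose images
`Ψg xₙ` converge to a point of `O`.  A predicate (not a claim); its absence is the late-time content of the
relative-closedness clause G5 of the crux `StarvedNecks.NeckGapDecay`. [folklore] -/
def LateEscape (𝓢 : Spacetime.{0} 4) (O : Set 𝓢.carrier) (B : ModelBackground) (Ψg : B.domain → 𝓢.carrier)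
    (R₁ τ₂ : ℝ) (W : ℝ → ℝ) : Prop :=
  ∃ (x : ℕ → B.domain) (p : 𝓢.carrier), p ∈ O ∧ Tendsto (fun n ↦ B.time (x n).1) atTop atTop ∧
    (∀ n, τ₂ ≤ B.time (x n).1 ∧ R₁ + 1 ≤ B.radius (x n).1 ∧ B.radius (x n).1 ≤ W ((x n).1 0)) ∧
    Tendsto (fun n ↦ Ψg (x n)) atTop (𝓝 p)

end Literature.Uncategorized
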